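import Literature.Analysis.FluidPDE.PassiveVectorTensorDistortedDuality
import HarnessLib

/-! # Certifier 3-probe (c): ORIENTATION of the two cross terms of `EnergyDuhamelG` (custody
`HOME/ad-ideate-lit/drafts/…VmodFrameDefsJD.v1.lean`, sha16 c1a1abc79a86e304) against the TREE's conventions
(planner ad-ideate-p5 g17; examples only, nothing to land).

The clause's Duhamel cross identity reads
`⟪U s t₀ x, φ⟫ − ⟪T s t₀ x, φ⟫ = ∫_{τ∈(0,t₀−s]} ( Σⱼ ∫⟪(bU (s+τ))ⱼ • w τ, DΨ (t₀−s−τ) j⟫  −  ∫ Σ_{l,i,c,e} conj(G(s+τ))(𝔸U−𝔸T)_{icle} (DΨ (t₀−s−τ) c)_i (Dw τ e)_l )`.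
With the class convention `∂ₜw + (b·∇)w = 𝓛^{G}_{𝔸} w` (weak form: `∫⟪w, ∂ₜψ + (b·∇)ψ + 𝓛^{G,*}ψ⟫ = 0`, `div b = 0`) and
`g(r) := ⟪U(s,r)x, T(r,t₀)†φ⟫`, `g' = ⟪(L_U − L_T) w, Ψ⟫ = ⟪w, (bU·∇)Ψ⟫ + ⟪w, 𝓛^{conj G (𝔸U−𝔸T),*} Ψ⟫`:
(c₂) the transport pairing is `+ Σⱼ ⟪bⱼ • w, ∂ⱼΨ⟫` (derivative on the TEST side), and
(c₁) the viscous pairing is `− ∫ Σ 𝔹_{icle} (∂_cΨ)_i (∂_e w)_l` with 𝔹 = conj G (𝔸U − 𝔸T): TEST gradient in `(c,i)`, SOLUTION gradient in `(e,l)` —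
exactly the tree's one-integration-by-parts identity `integral_inner_viscAdjVar_eq_neg_integral_sum` (below, instantiated), and the same
cross structure as the PROVED two-member Duhamel `IsWeakTensorPassiveVectorDistortedOn.ae_integral_inner_twoMember_eq` with `b₂ = 0`
(time reversal `ψ τ = Ψ (t₀−s−τ)` is the only re-indexing); and (c₃) at `G ≡ 1`, `s = 0` the clause's density IS the density of the
PROVED flat theorem `IsWeakTensorPassiveVectorOn.twoProblemDuality_physical` (p729623) with `b₂ = 0`. -/

open MeasureTheory
open scoped InnerProductSpace
open Literature.Analysis Literature.Analysis.FluidPDE Literature.Analysis.FunctionSpaces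

namespace P5g17OrientProbe

abbrev VF := UnitAddTorus (Fin 3) → EuclideanSpace ℝ (Fin 3)

/-- (c₁) ORIENTATION of the VISCOUS cross term = the tree's pairing identity for the divergence-form TEST operator with the
coefficient field `y ↦ (𝔸U − 𝔸T)^{G(y)}`: TEST gradient in the `(c,i)` slots, SOLUTION weak gradient in the `(e,l)` slots
(`(Gv x (single e 1)) l = (∂ₑ v)_l` is the clause's `(Dw τ e y) l`). -/
example (Gy : UnitAddTorus (Fin 3) → Matrix (Fin 3) (Fin 3) ℝ) (𝔸U 𝔸T : Torus.Visc4 (Fin 3)) (Ψ v : VF)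
    (Gv : UnitAddTorus (Fin 3) → EuclideanSpace ℝ (Fin 3) →L[ℝ] EuclideanSpace ℝ (Fin 3))
    (h𝔹 : ∀ i c l e, Torus.IsSmooth (fun y => Torus.Visc4.conj (Gy y) (𝔸U - 𝔸T) i c l e))
    (hΨ : Torus.IsSmooth Ψ) (hv : Integrable v volume) (hG : Torus.HasWeakGradient v Gv) (hGi : Integrable Gv volume) :
    ∫ x, ⟪v x, Torus.viscAdjVar (fun y => Torus.Visc4.conj (Gy y) (𝔸U - 𝔸T)) Ψ x⟫_ℝ =
      -∫ x, ∑ l, ∑ i, ∑ c, ∑ e, Torus.Visc4.conj (Gy x) (𝔸U - 𝔸T) i c l e *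
        (Torus.partialDeriv c Ψ x) i * (Gv x (EuclideanSpace.single e 1)) l :=
  Literature.Analysis.FluidPDE.Torus.integral_inner_viscAdjVar_eq_neg_integral_sum h𝔹 hΨ hv hG hGi

/-- (c₂) ORIENTATION of the TRANSPORT cross term: pointwise `⟪w, (b·∇)Ψ⟫ = Σⱼ ⟪bⱼ • w, ∂ⱼΨ⟫` for `C¹` tests — the clause's
`Σⱼ ∫⟪(bU)ⱼ • w, DΨⱼ⟫` is the weak-gradient form of `∫⟪w, convect bU Ψ⟫` of L24 (O4)/(O5) and of
`…PassiveVectorTensorDistortedDuhamel.ae_integral_inner_twoMember_eq` with `b₂ = 0` (sign `+`, test derivative, no derivative on `w`). -/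
example (b Ψ w : VF) (hΨ : Torus.IsContDiff 1 Ψ) (y : UnitAddTorus (Fin 3)) :
    ⟪w y, Torus.convect b Ψ y⟫_ℝ = ∑ j, ⟪(b y) j • w y, Torus.partialDeriv j Ψ y⟫_ℝ := by
  rw [Torus.convect, Torus.fderiv_apply_eq_sum_partialDeriv hΨ y (b y), inner_sum]
  refine Finset.sum_congr rfl fun j _ => ?_
  rw [real_inner_smul_left, real_inner_smul_right]


/-- (c₃) SHAPE-MATCH with the PROVED flat two-problem duality `IsWeakTensorPassiveVectorOn.twoProblemDuality_physical`
(ad-lit g33, p729623 ACCEPTED 15:39Z): its density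
`σ ↦ (Σⱼ ∫⟪(b₁ σ x j − b₂ σ x j) • u σ x, Dψ (t₀−σ) j x⟫) − ∫ Σ_{l,i,c,e} (𝔸₁−𝔸₂) i c l e (Dψ (t₀−σ) c x)_i (Du σ e x)_l` with `b₂ = 0`
IS, term for term, the density of `EnergyDuhamelG`'s cross identity at base time `s = 0` and frame `G ≡ 1` (right-hand side below =
the clause's last conjunct with `s := 0`, `G := fun _ _ => 1`, `τ := σ`, witnesses renamed).  So the clause's orientation — transport `+`
with the derivative on the TEST, viscous `−` with the TEST gradient in `(c,i)` and the SOLUTION gradient in `(e,l)`, window `Ioc 0 (t₀ − s)`,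
reversed clock `t₀ − s − τ` on the adjoint gradient — is that of a KERNEL-PROVED theorem (`g t₀ − h t₀ = ∫ σ in Ioc 0 t₀, density σ`,
`g t₀ = ∫⟪u t₀, φ⟫`, `h t₀ = ∫⟪ψ t₀, u₀⟫`), not a convention chosen in the definitions file. -/
example (𝔸U 𝔸T : Torus.Visc4 (Fin 3)) (bU : ℝ → VF) (w : ℝ → VF) (DΨ Dw : ℝ → Fin 3 → VF) (t₀ σ : ℝ) :
    ((∑ j, ∫ x, ⟪(bU σ x j - (0 : ℝ → VF) σ x j) • w σ x, DΨ (t₀ - σ) j x⟫_ℝ) -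
        ∫ x, ∑ l, ∑ i, ∑ c, ∑ e, (𝔸U - 𝔸T) i c l e * (DΨ (t₀ - σ) c x) i * (Dw σ e x) l) =
      ((∑ j, ∫ y, ⟪(bU (0 + σ) y) j • w σ y, DΨ (t₀ - 0 - σ) j y⟫_ℝ) -
        ∫ y, ∑ l, ∑ i, ∑ c, ∑ e,
          Torus.Visc4.conj ((fun (_ : ℝ) (_ : UnitAddTorus (Fin 3)) => (1 : Matrix (Fin 3) (Fin 3) ℝ)) (0 + σ) y) (𝔸U - 𝔸T) i c l e *
            (DΨ (t₀ - 0 - σ) c y) i * (Dw σ e y) l) := by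
  simp [Torus.Visc4.conj_one]

-- (c₃′) by-name existence check `example := @…IsWeakTensorPassiveVectorOn.twoProblemDuality_physical_split (Fin 3)` deferred: the module
-- `…TwoProblemDualityPhysical` (p729623, 15:39Z) is accepted but its olean was not yet served on the farm at 15:50Z (lean check rc 75 `unbuilt`).

end P5g17OrientProbe
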